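import Mathlib

/-!
# T5UnramifiedOfGalois — «degree one ⇒ p ∤ D_F» for a Galois number field

Kernel form of the step S0 of route/T5-CHECK-G-p7.md (ref-4's correction G-R4-1; §12.2 rows
P1.4 / P1.9): Hsieh's standing hypothesis (unr) «2 < p ∤ D_F» (arXiv:1112.1574 v3, PHFVmu.tex
ll. 17–18) holds for the datum because the chosen prime 𝔭 of the totally real cubic field F
(Galois over ℚ) has [F_𝔭 : ℚ_p] = 1, i.e. ramification index e = 1 (and inertia degree f = 1).

* `ramificationIdx_eq_of_isGalois`: in a number field `K` Galois over `ℚ`, two primes of the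
  ring of integers lying over the same rational prime have the same ramification index
  (Mathlib's `Ideal.ramificationIdx_eq_of_isGaloisGroup`, instantiated on the ring of
  integers through `IsIntegralClosure.MulSemiringAction` / `IsGaloisGroup.of_isFractionRing`).
* `isUnramifiedAt_of_isGalois`: one unramified prime above `p` ⇒ every prime above `p`
  is unramified.
* `not_dvd_discr_of_isGalois_of_ramificationIdx_eq_one`: one prime `P` above `p` with
  `e(P | ℤ) = 1` ⇒ `p ∤ discr K` (`NumberField.not_dvd_discr_iff_forall_mem`).
* `not_dvd_discr_of_isGalois_of_degree_one`: the datum form, hypothesis `e · f = 1`.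
* `unr_of_isGalois_of_degree_one`: the packaged (unr): `2 < p ∧ ¬ (p : ℤ) ∣ discr K`.

Nothing about CM fields, Hecke characters or L-functions is asserted: the file certifies the
number-theoretic sentence only.  Mathlib only; standard axioms.
-/

open scoped NumberField nonZeroDivisors

namespace Summit.Ventures.HodgeRepro2.T5UnramifiedOfGalois

variable {K 𝒪 : Type*} [Field K] [NumberField K] [CommRing 𝒪] [Algebra 𝒪 K]
variable [IsIntegralClosure 𝒪 ℤ K]

/-- In a number field `K` Galois over `ℚ`, two primes `P`, `Q` of the ring of integers `𝒪`
lying over the same rational prime `p` have the same ramification index over `ℤ`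
(transitivity of the Galois action on the primes above `p`). -/
theorem ramificationIdx_eq_of_isGalois [IsGalois ℚ K] {p : ℤ} (hp : Prime p)
    (P Q : Ideal 𝒪) [P.IsPrime] [Q.IsPrime] (hP : (p : 𝒪) ∈ P) (hQ : (p : 𝒪) ∈ Q) :
    P.ramificationIdx ℤ = Q.ramificationIdx ℤ := by
  have := (IsIntegralClosure.algebraMap_injective 𝒪 ℤ K).isDomain
  have := IsIntegralClosure.isDedekindDomain ℤ ℚ K 𝒪
  have := IsIntegralClosure.isFractionRing_of_finite_extension ℤ ℚ K 𝒪
  have := IsIntegralClosure.finite ℤ ℚ K 𝒪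
  have := CharZero.of_module (R := 𝒪) K
  let : MulSemiringAction Gal(K/ℚ) 𝒪 := IsIntegralClosure.MulSemiringAction ℤ ℚ K 𝒪
  have := IsGaloisGroup.of_isFractionRing Gal(K/ℚ) ℤ 𝒪 ℚ K
  have hP' : P.LiesOver (Ideal.span {p}) :=
    (Ideal.liesOver_span_iff Ideal.IsPrime.ne_top' hp).mpr hP
  have hQ' : Q.LiesOver (Ideal.span {p}) :=
    (Ideal.liesOver_span_iff Ideal.IsPrime.ne_top' hp).mpr hQ
  exact Ideal.ramificationIdx_eq_of_isGaloisGroup (Ideal.span {p}) P Q Gal(K/ℚ)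

/-- In a number field `K` Galois over `ℚ`: if one prime `P` above the rational prime `p` is
unramified over `ℤ`, then every prime `Q` above `p` is unramified over `ℤ`. -/
theorem isUnramifiedAt_of_isGalois [IsGalois ℚ K] {p : ℤ} (hp : Prime p)
    (P : Ideal 𝒪) [P.IsPrime] (hP : (p : 𝒪) ∈ P) [Algebra.IsUnramifiedAt ℤ P]
    (Q : Ideal 𝒪) [Q.IsPrime] (hQ : (p : 𝒪) ∈ Q) :
    Algebra.IsUnramifiedAt ℤ Q := by
  have := (IsIntegralClosure.algebraMap_injective 𝒪 ℤ K).isDomain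
  have := IsIntegralClosure.isDedekindDomain ℤ ℚ K 𝒪
  have := IsIntegralClosure.finite ℤ ℚ K 𝒪
  have := CharZero.of_module (R := 𝒪) K
  rw [← Ideal.ramificationIdx_eq_one_iff, ramificationIdx_eq_of_isGalois (K := K) hp Q P hQ hP,
    Ideal.ramificationIdx_eq_one_iff]
  infer_instance

/-- **G-R4-1 / S0 in kernel form.** Let `K` be a number field Galois over `ℚ` and `p` a rational
prime.  If ONE prime `P` of the ring of integers above `p` has ramification index `e(P | ℤ) = 1`,
then `p` does not divide the discriminant of `K`. -/
theorem not_dvd_discr_of_isGalois_of_ramificationIdx_eq_one [IsGalois ℚ K] {p : ℤ}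
    (hp : Prime p) (P : Ideal 𝒪) [P.IsPrime] (hP : (p : 𝒪) ∈ P)
    (he : P.ramificationIdx ℤ = 1) :
    ¬ p ∣ NumberField.discr K := by
  have := (IsIntegralClosure.algebraMap_injective 𝒪 ℤ K).isDomain
  have := IsIntegralClosure.isDedekindDomain ℤ ℚ K 𝒪
  have := IsIntegralClosure.finite ℤ ℚ K 𝒪
  have := CharZero.of_module (R := 𝒪) K
  have : Algebra.IsUnramifiedAt ℤ P := Ideal.ramificationIdx_eq_one_iff.mp he
  rw [NumberField.not_dvd_discr_iff_forall_mem K 𝒪 hp]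
  intro Q hQ hpQ
  exact isUnramifiedAt_of_isGalois (K := K) hp P hP Q hpQ

/-- The datum form: a prime `P` above `p` of **degree one**, `e(P | ℤ) · f(P | ℤ) = 1`
(«[F_𝔭 : ℚ_p] = 1», N0 (D6)), forces `p ∤ discr K` when `K/ℚ` is Galois. -/
theorem not_dvd_discr_of_isGalois_of_degree_one [IsGalois ℚ K] {p : ℤ}
    (hp : Prime p) (P : Ideal 𝒪) [P.IsPrime] (hP : (p : 𝒪) ∈ P)
    (hef : P.ramificationIdx ℤ * P.inertiaDeg ℤ = 1) :
    ¬ p ∣ NumberField.discr K :=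
  not_dvd_discr_of_isGalois_of_ramificationIdx_eq_one (K := K) hp P hP
    (Nat.eq_one_of_mul_eq_one_right hef)

/-- Hsieh's standing hypothesis (unr) «2 < p ∤ D_F» (arXiv:1112.1574 v3, PHFVmu.tex ll. 17–18;
CHECK-G §12.2 row P1.4), packaged for a rational prime `p : ℕ`: it holds as soon as `p > 2` and
some prime of the ring of integers above `p` has degree one, `K/ℚ` Galois. -/
theorem unr_of_isGalois_of_degree_one [IsGalois ℚ K] {p : ℕ} (hp : p.Prime) (h2 : 2 < p)
    (P : Ideal 𝒪) [P.IsPrime] (hP : (p : 𝒪) ∈ P)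
    (hef : P.ramificationIdx ℤ * P.inertiaDeg ℤ = 1) :
    2 < p ∧ ¬ (p : ℤ) ∣ NumberField.discr K :=
  ⟨h2, not_dvd_discr_of_isGalois_of_degree_one (K := K) (Nat.prime_iff_prime_int.mp hp) P
    (by exact_mod_cast hP) hef⟩

end Summit.Ventures.HodgeRepro2.T5UnramifiedOfGalois
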